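import Literature.Probability.LatticeModels.CornerPermutation
import HarnessLib

/-!
# The FK interface under toggling one edge: exit corner, and the three cases

Topic `Literature/Probability/LatticeModels`; fifth instalment of the discharge programme for
crit-ising.S18, node 1 (s-holomorphicity, Smirnov 2010 Lemma 4.5), completing the combinatorial
half of "the rearrangement of connections at the point `v`" begun in `CornerPermutation.lean`
(the turning rule is a permutation; toggling the edge `e = cTgt p` composes it with the
transposition of `p` and its partner; the interface cycle). Everything here is proved.

* `DiscreteDobrushin.IsExitCorner`, `existsUnique_isExitCorner`: the corner `(x, j)` with `x` on
  the arc `A`, its target edge ending on the arc `B` and *targeted* at `x` — the last dart of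
  every exploration path (`isExitCorner_cornerOrbit`, from `cornerOrbit_exit`) — is unique
  (sourced and targeted `A`–`B` edges are equinumerous and the sourced one is the unique start
  corner); so **all explorations, whatever the configuration, end with the same dart**.
* The orbit of the start corner in the toggled configuration `β'` versus the original `β`
  (`β`, `β'` completed configurations agreeing off `e` and differing at `e`), with `N` the
  original exit time:
  - `cornerOrbit_toggle_case0`: neither corner of `e` is a dart of the path ⇒ the orbits agree
    up to time `N` (same path);
  - `cornerOrbit_toggle_case2`, `exit_toggle_case2`: both are, `p = orb i₁` before its partner
    `orb i₂` ⇒ the toggled path is `orb 0 … orb i₁, orb (i₂+1) … orb N`: the stretch between the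
    two visits of `e` is excised (it closes up into a separate cycle), exit at time
    `N - (i₂ - i₁)`;
  - `cornerOrbit_toggle_case1`: `p = orb i₁` is a dart but its partner `p₂` is not, `e` interior
    ⇒ the toggled path is `orb 0 … orb i₁`, then once around the cycle `L` of `p₂` under the
    original rule (from the successor of `p₂` back to `p₂`, period `Q`), then `orb (i₁+1) … orb N`:
    `L` is spliced in, exit at time `N + Q`, all earlier faces inner. Inputs: `L` never meets the
    interface cycle (its inner corners would be darts, `isInnerFace_cornerOrbit_iff`), and `L`
    consists of inner corners (the toggled path can only exit through the exit corner, which is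
    on the interface cycle).

These are exactly the configurations `ω`, `ω'` of Smirnov's table (proof of Lemma 4.5): "in one
of the curves, say `γ(ω)`, the two traced halves are immediately joined (and there is also a
cycle passing near `v`), whereas in the other, `γ(ω')`, this cycle is included into the curve".
The weights of the pair (`FKInterfacePairing.lean`) and the windings along the three pieces
(`ExplorationWinding.lean`) are combined in the next instalment.

Sources: Smirnov, Ann. Math. 172 (2010), proof of Lemma 4.5 and Fig. 5; Smirnov, C. R. Acad.
Sci. Paris 333 (2001), §2.
-/

noncomputable section

namespace Literature.Probability.LatticeModels

open SimpleGraph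

namespace DiscreteDobrushin

variable {D : DiscreteDobrushin}

/-- `D.IsExitCorner q`: the coded corner `q = (x, j)` is an *exit corner* of the Dobrushin data —
its vertex `x` lies on the arc `A`, the other endpoint `x + u_{j+1}` of its target edge lies on
the arc `B`, and that target edge is *targeted* at its `A`-end (`IsInEdge x (j+1)`: the face of
`q` is inner, the face across the target edge is not). The last dart of every exploration path is
an exit corner (`cornerOrbit_exit`), and there is exactly one (`existsUnique_isExitCorner`): its
target edge is `e_b`. [cite: Smirnov2001, §2] -/
structure IsExitCorner (D : DiscreteDobrushin) (q : Site 2 × Fin 4) : Prop where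
  /-- The vertex lies on the discrete arc `A`. -/
  mem_zdArcA : q.1 ∈ D.zdArcA
  /-- The other endpoint of the target edge lies on the discrete arc `B`. -/
  mem_zdArcB : q.1 + cornerUnit (q.2 + 1) ∈ D.zdArcB
  /-- The target edge is targeted at the vertex: the face is inner, the face across is not. -/
  isInEdge : D.IsInEdge q.1 (q.2 + 1)

open scoped Classical in
/-- **Exactly one exit corner.** Counting as for `existsUnique_startCorner`: sourced and targeted
`A`–`B` edges are equinumerous (`card_out_arcB_eq_card_in_arcB`) and there is exactly one
sourced one (the start corner), so there is exactly one targeted one. [cite: Smirnov2001, §2] -/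
theorem existsUnique_isExitCorner (hD : D.IsZdAdmissible) : ∃! q : Site 2 × Fin 4, D.IsExitCorner q := by
  have hAfin : D.zdArcA.Finite := (meshDomain_finite hD.isBounded hD.delta_pos).subset
    (D.zdArcA_subset_zdBoundary.trans D.zdBoundary_subset_meshDomain)
  set A := hAfin.toFinset with hAdef
  have hA : ∀ x, x ∈ A ↔ x ∈ D.zdArcA := fun x => by rw [hAdef, Set.Finite.mem_toFinset]
  set TO := (A ×ˢ Finset.univ).filter fun p : Site 2 × Fin 4 =>
    D.IsOutEdge p.1 p.2 ∧ p.1 + cornerUnit p.2 ∈ D.zdArcB with hTO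
  set TI := (A ×ˢ Finset.univ).filter fun p : Site 2 × Fin 4 =>
    D.IsInEdge p.1 p.2 ∧ p.1 + cornerUnit p.2 ∈ D.zdArcB with hTI
  have memTO : ∀ p, p ∈ TO ↔ p.1 ∈ D.zdArcA ∧ D.IsOutEdge p.1 p.2 ∧ p.1 + cornerUnit p.2 ∈ D.zdArcB := by
    intro p; simp only [hTO, Finset.mem_filter, Finset.mem_product, Finset.mem_univ, and_true, hA]
  have memTI : ∀ p, p ∈ TI ↔ p.1 ∈ D.zdArcA ∧ D.IsInEdge p.1 p.2 ∧ p.1 + cornerUnit p.2 ∈ D.zdArcB := by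
    intro p; simp only [hTI, Finset.mem_filter, Finset.mem_product, Finset.mem_univ, and_true, hA]
  have hbal : TO.card = TI.card := card_out_arcB_eq_card_in_arcB hD A hA
  obtain ⟨c₀, hc₀, huniq⟩ := existsUnique_startCorner hD
  have hTO1 : TO.card = 1 := by
    rw [Finset.card_eq_one]
    refine ⟨c₀, Finset.eq_singleton_iff_unique_mem.2 ⟨(memTO _).2 ⟨hc₀.1, hc₀.2.2, hc₀.2.1⟩, fun q hq => ?_⟩⟩
    have h := (memTO q).1 hq
    exact huniq q ⟨h.1, h.2.2, h.2.1⟩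
  rw [hTO1] at hbal
  obtain ⟨e, he⟩ := Finset.card_eq_one.1 hbal.symm
  have heTI : e ∈ TI := by rw [he]; exact Finset.mem_singleton_self _
  obtain ⟨h1, h2, h3⟩ := (memTI e).1 heTI
  refine ⟨(e.1, e.2 + 3), ⟨h1, by rwa [fin4_add_three_add_one], by rwa [fin4_add_three_add_one]⟩, ?_⟩
  rintro q ⟨hq1, hq2, hq3⟩
  have : (q.1, q.2 + 1) ∈ TI := (memTI _).2 ⟨hq1, hq3, hq2⟩
  rw [he, Finset.mem_singleton] at this
  rw [← this]
  exact Prod.ext rfl (fin4_add_one_add_three q.2).symm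

/-- Exit corners are unique. [cite: Smirnov2001, §2] -/
theorem IsExitCorner.eq (hD : D.IsZdAdmissible) {q q' : Site 2 × Fin 4} (hq : D.IsExitCorner q)
    (hq' : D.IsExitCorner q') : q = q' :=
  (existsUnique_isExitCorner hD).unique hq hq'

end DiscreteDobrushin

section Exit

variable {D : DiscreteDobrushin} {ω : Percolation.BondConfig (Site 2)} {c₀ : Site 2 × Fin 4}

/-- **The last dart of the exploration is the exit corner** (whatever the configuration): at the
exit time of the orbit of the start corner, the previous corner is an exit corner
(`cornerOrbit_exit`). [cite: Smirnov2001, §2] -/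
theorem isExitCorner_cornerOrbit (hD : D.IsZdAdmissible) (hc₀ : D.IsStartCorner c₀) {n : ℕ}
    (hin : D.IsInnerFace (cFace (cornerOrbit (D.bcBondConfig ω) c₀ n)))
    (hout : ¬ D.IsInnerFace (cFace (cornerOrbit (D.bcBondConfig ω) c₀ (n + 1)))) :
    D.IsExitCorner (cornerOrbit (D.bcBondConfig ω) c₀ n) := by
  obtain ⟨-, hA, hB, hIn⟩ := cornerOrbit_exit hD hc₀ hin hout
  exact ⟨hA, hB, hIn⟩

end Exit


/-! ### The interface under toggling one edge: the three cases -/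

section Cases

variable {D : DiscreteDobrushin} {ω ω' : Percolation.BondConfig (Site 2)} {c₀ p : Site 2 × Fin 4}

local notation "β" => D.bcBondConfig ω
local notation "β'" => D.bcBondConfig ω'
local notation "orb" => cornerOrbit (D.bcBondConfig ω) c₀
local notation "orb'" => cornerOrbit (D.bcBondConfig ω') c₀

/-- One step of the toggled orbit from a corner that is neither `p` nor its partner is the
untoggled step. [cite: Smirnov2010, proof of Lemma 4.5] -/
theorem nextCorner_toggle_of_ne (hagree : ∀ e, e ≠ cTgt p → (e ∈ β' ↔ e ∈ β))
    (hdiff : ¬ (cTgt p ∈ β' ↔ cTgt p ∈ β)) {q : Site 2 × Fin 4} (h1 : q ≠ p) (h2 : q ≠ cornerPartner p) :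
    nextCorner β' q = nextCorner β q := by
  rw [nextCorner_toggle hagree hdiff q, Equiv.swap_apply_of_ne_of_ne h1 h2]

/-- **Case 0: the edge is not on the path.** If neither corner arriving at the toggled edge is a
dart of the exploration path (times `< N`), the toggled orbit agrees with the original one up to
the exit time `N` (so the two exploration paths coincide). [cite: Smirnov2010, proof of Lemma 4.5] -/
theorem cornerOrbit_toggle_case0 (hagree : ∀ e, e ≠ cTgt p → (e ∈ β' ↔ e ∈ β))
    (hdiff : ¬ (cTgt p ∈ β' ↔ cTgt p ∈ β)) {N : ℕ} (h1 : ∀ i < N, orb i ≠ p)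
    (h2 : ∀ i < N, orb i ≠ cornerPartner p) : ∀ i ≤ N, orb' i = orb i := by
  intro i hi
  induction i with
  | zero => rfl
  | succ i ih =>
    rw [cornerOrbit_succ, cornerOrbit_succ, ih (by omega)]
    exact nextCorner_toggle_of_ne hagree hdiff (h1 i (by omega)) (h2 i (by omega))

/-- **Case 2: both corners of the edge are on the path, `p` first.** If `p = orb i₁` and its
partner is `orb i₂` with `i₁ < i₂ < N`, then the toggled orbit follows the original one up to
time `i₁`, jumps from `p` to the successor of its partner, and then runs along the original
orbit shifted by `i₂ - i₁`: `orb' (i₁ + 1 + j) = orb (i₂ + 1 + j)` up to the original exit.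
(The stretch `orb (i₁+1), …, orb i₂` is excised; in the toggled configuration it closes up into
a separate cycle through the partner.) [cite: Smirnov2010, proof of Lemma 4.5] -/
theorem cornerOrbit_toggle_case2 (hD : D.IsZdAdmissible) (hc₀ : D.IsStartCorner c₀)
    (hagree : ∀ e, e ≠ cTgt p → (e ∈ β' ↔ e ∈ β)) (hdiff : ¬ (cTgt p ∈ β' ↔ cTgt p ∈ β))
    {N i₁ i₂ : ℕ} (hlt : ∀ k < N, D.IsInnerFace (cFace (orb k))) (hi₁ : orb i₁ = p)
    (hi₂ : orb i₂ = cornerPartner p) (h12 : i₁ < i₂) (hi₂N : i₂ < N) :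
    (∀ i ≤ i₁, orb' i = orb i) ∧ ∀ j, i₂ + 1 + j ≤ N → orb' (i₁ + 1 + j) = orb (i₂ + 1 + j) := by
  -- darts of the path are distinct
  have hinj : ∀ a b, a < N → b < N → orb a = orb b → a = b := by
    intro a b ha hb h
    by_contra hne
    rcases Nat.lt_or_gt_of_ne hne with hab | hab
    · exact cornerOrbit_ne hD hc₀ hab (fun k hk => hlt k (by omega)) h
    · exact cornerOrbit_ne hD hc₀ hab (fun k hk => hlt k (by omega)) h.symm
  have hpre : ∀ i ≤ i₁, orb' i = orb i := by
    intro i hi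
    induction i with
    | zero => rfl
    | succ i ih =>
      rw [cornerOrbit_succ, cornerOrbit_succ, ih (by omega)]
      refine nextCorner_toggle_of_ne hagree hdiff (fun h => ?_) (fun h => ?_)
      · have := hinj i i₁ (by omega) (by omega) (h.trans hi₁.symm); omega
      · have := hinj i i₂ (by omega) (by omega) (h.trans hi₂.symm); omega
  refine ⟨hpre, fun j => ?_⟩
  induction j with
  | zero =>
    intro _
    rw [add_zero, add_zero, cornerOrbit_succ, cornerOrbit_succ, hpre i₁ le_rfl, hi₁, hi₂,
      nextCorner_toggle hagree hdiff, Equiv.swap_apply_left]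
  | succ j ih =>
    intro hj
    rw [← add_assoc, cornerOrbit_succ, ih (by omega), ← add_assoc, cornerOrbit_succ]
    refine nextCorner_toggle_of_ne hagree hdiff (fun h => ?_) (fun h => ?_)
    · have := hinj _ _ (by omega) (by omega) (h.trans hi₁.symm); omega
    · have := hinj _ _ (by omega) (by omega) (h.trans hi₂.symm); omega

/-- In Case 2 the toggled exploration exits at time `N - (i₂ - i₁)`, through the same corner.
[cite: Smirnov2010, proof of Lemma 4.5] -/
theorem exit_toggle_case2 (hD : D.IsZdAdmissible) (hc₀ : D.IsStartCorner c₀)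
    (hagree : ∀ e, e ≠ cTgt p → (e ∈ β' ↔ e ∈ β)) (hdiff : ¬ (cTgt p ∈ β' ↔ cTgt p ∈ β))
    {N i₁ i₂ : ℕ} (hN : ¬ D.IsInnerFace (cFace (orb N))) (hlt : ∀ k < N, D.IsInnerFace (cFace (orb k)))
    (hi₁ : orb i₁ = p) (hi₂ : orb i₂ = cornerPartner p) (h12 : i₁ < i₂) (hi₂N : i₂ < N) :
    ¬ D.IsInnerFace (cFace (orb' (N - (i₂ - i₁)))) ∧
      ∀ k < N - (i₂ - i₁), D.IsInnerFace (cFace (orb' k)) := by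
  obtain ⟨hpre, htail⟩ := cornerOrbit_toggle_case2 hD hc₀ hagree hdiff hlt hi₁ hi₂ h12 hi₂N
  constructor
  · have := htail (N - i₂ - 1) (by omega)
    rw [show i₁ + 1 + (N - i₂ - 1) = N - (i₂ - i₁) by omega, show i₂ + 1 + (N - i₂ - 1) = N by omega] at this
    rwa [this]
  · intro k hk
    by_cases hk1 : k ≤ i₁
    · rw [hpre k hk1]; exact hlt k (by omega)
    · have := htail (k - i₁ - 1) (by omega)
      rw [show i₁ + 1 + (k - i₁ - 1) = k by omega] at this
      rw [this]
      exact hlt _ (by omega)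


/-- Corners of inner faces have their vertex in `Ω_δ` (for `exists_cornerOrbit_period`).
[cite: Smirnov2001, §2] -/
theorem fst_mem_meshDomain_of_isInnerFace {q : Site 2 × Fin 4} (h : D.IsInnerFace (cFace q)) :
    q.1 ∈ meshDomain D.Ω D.δ :=
  mem_meshDomain_of_isCorner_of_isInnerFace (isCorner_cFace q) h

/-- An endpoint of the target edge of an exit corner is a corner of a non-inner face (the face
across `e_b`). Used to tell the toggled interior edge from `e_b`. [cite: Smirnov2001, §2] -/
theorem DiscreteDobrushin.IsExitCorner.not_forall_isInnerFace {q : Site 2 × Fin 4} (hq : D.IsExitCorner q) :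
    ¬ ∀ j, D.IsInnerFace (faceAt q.1 j) :=
  fun h => hq.isInEdge.2 (h _)

/-- **Case 1: exactly one corner of the edge is on the path.** Let `p = orb i₁` (`i₁ < N`) be a
dart of the exploration path whose partner `p₂` is not, the toggled edge `e = cTgt p` having
both endpoints away from the boundary (all faces at them inner). Let `Q` be the (minimal) period
of the orbit `L` of `p₂` under the *original* turning rule. Then the toggled orbit runs along the
original path up to `p`, follows `e` into the successor of `p₂` and once around `L` back to
`p₂` (times `i₁ + 1, …, i₁ + Q`), follows `e` back to the successor of `p`, and finishes along
the original path: it exits at time `N + Q` through the same exit corner, all earlier faces being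
inner. (The loop `L` is spliced into the path; `L` is disjoint from the interface cycle since its
inner corners would be darts of the path, `isInnerFace_cornerOrbit_iff`, and it consists of inner
corners since the toggled path can only exit through the exit corner, which lies on the
interface cycle, `IsExitCorner.eq`.) [cite: Smirnov2010, proof of Lemma 4.5] -/
theorem cornerOrbit_toggle_case1 (hD : D.IsZdAdmissible) (hc₀ : D.IsStartCorner c₀)
    (hagree : ∀ e, e ≠ cTgt p → (e ∈ β' ↔ e ∈ β)) (hdiff : ¬ (cTgt p ∈ β' ↔ cTgt p ∈ β))
    (hx : ∀ j, D.IsInnerFace (faceAt p.1 j)) (hy : ∀ j, D.IsInnerFace (faceAt (p.1 + cornerUnit (p.2 + 1)) j))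
    {N P Q i₁ : ℕ} (hN : ¬ D.IsInnerFace (cFace (orb N))) (hlt : ∀ k < N, D.IsInnerFace (cFace (orb k)))
    (hP0 : 0 < P) (hP : orb P = c₀) (hPmin : ∀ s, 0 < s → s < P → orb s ≠ c₀)
    (hQ0 : 0 < Q) (hQ : cornerOrbit β (cornerPartner p) Q = cornerPartner p)
    (hQmin : ∀ s, 0 < s → s < Q → cornerOrbit β (cornerPartner p) s ≠ cornerPartner p)
    (hi₁ : orb i₁ = p) (hi₁N : i₁ < N) (h₂ : ∀ i < N, orb i ≠ cornerPartner p) :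
    (∀ i ≤ i₁, orb' i = orb i) ∧
    (∀ j, j + 1 ≤ Q → orb' (i₁ + 1 + j) = cornerOrbit β (cornerPartner p) (j + 1)) ∧
    (∀ j, i₁ + 1 + j ≤ N → orb' (i₁ + Q + 1 + j) = orb (i₁ + 1 + j)) ∧
    (∀ k < N + Q, D.IsInnerFace (cFace (orb' k))) ∧ ¬ D.IsInnerFace (cFace (orb' (N + Q))) := by
  set p₂ := cornerPartner p with hp₂
  have hp₂inner : D.IsInnerFace (cFace p₂) := hy _
  -- darts of the path are distinct
  have hinj : ∀ a b, a < N → b < N → orb a = orb b → a = b := by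
    intro a b ha hb h
    by_contra hne
    rcases Nat.lt_or_gt_of_ne hne with hab | hab
    · exact cornerOrbit_ne hD hc₀ hab (fun k hk => hlt k (by omega)) h
    · exact cornerOrbit_ne hD hc₀ hab (fun k hk => hlt k (by omega)) h.symm
  -- Step A: the loop through the partner never meets the interface cycle
  have hdisj : ∀ m s, cornerOrbit β p₂ m ≠ orb s := by
    intro m s h
    obtain ⟨s', hs'⟩ := exists_eq_cornerOrbit_of_iterate hP0 hP m h
    have hin : D.IsInnerFace (cFace (orb s')) := hs' ▸ hp₂inner
    rw [isInnerFace_cornerOrbit_iff hD hc₀ hN hlt hP0 hP hPmin] at hin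
    exact h₂ _ hin (by rw [cornerOrbit_mod_period hP]; exact hs'.symm)
  -- the prefix
  have hpre : ∀ i ≤ i₁, orb' i = orb i := by
    intro i hi
    induction i with
    | zero => rfl
    | succ i ih =>
      rw [cornerOrbit_succ, cornerOrbit_succ, ih (by omega)]
      refine nextCorner_toggle_of_ne hagree hdiff (fun h => ?_) (fun h => h₂ i (by omega) h)
      have := hinj i i₁ (by omega) hi₁N (h.trans hi₁.symm); omega
  -- Step B: around the loop
  have hloop : ∀ j, j + 1 ≤ Q → orb' (i₁ + 1 + j) = cornerOrbit β p₂ (j + 1) := by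
    intro j hj
    induction j with
    | zero =>
      rw [add_zero, cornerOrbit_succ, hpre i₁ le_rfl, hi₁, nextCorner_toggle hagree hdiff, Equiv.swap_apply_left]
      rfl
    | succ j ih =>
      rw [← add_assoc, cornerOrbit_succ, ih (by omega)]
      change nextCorner β' (cornerOrbit β p₂ (j + 1)) = nextCorner β (cornerOrbit β p₂ (j + 1))
      refine nextCorner_toggle_of_ne hagree hdiff (fun h => hdisj (j + 1) i₁ (h.trans hi₁.symm)) ?_
      exact hQmin (j + 1) (Nat.succ_pos _) (by omega)
  -- Step C: back on the path
  have hback : orb' (i₁ + Q + 1) = orb (i₁ + 1) := by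
    have h1 : orb' (i₁ + Q) = p₂ := by
      have := hloop (Q - 1) (by omega)
      rwa [show i₁ + 1 + (Q - 1) = i₁ + Q by omega, Nat.sub_add_cancel hQ0, hQ] at this
    rw [cornerOrbit_succ, h1, nextCorner_toggle hagree hdiff, hp₂, Equiv.swap_apply_right, cornerOrbit_succ, hi₁]
  have htail : ∀ j, i₁ + 1 + j ≤ N → orb' (i₁ + Q + 1 + j) = orb (i₁ + 1 + j) := by
    intro j hj
    induction j with
    | zero => rw [add_zero, add_zero, hback]
    | succ j ih =>
      rw [← add_assoc, cornerOrbit_succ, ih (by omega), ← add_assoc, cornerOrbit_succ]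
      refine nextCorner_toggle_of_ne hagree hdiff (fun h => ?_) (fun h => h₂ _ (by omega) h)
      have := hinj _ _ (by omega) hi₁N (h.trans hi₁.symm); omega
  -- Step D: the loop consists of inner corners
  have hloopin : ∀ j, j + 1 ≤ Q → D.IsInnerFace (cFace (cornerOrbit β p₂ (j + 1))) := by
    by_contra hcon
    push Not at hcon
    -- first bad time on the loop
    classical
    let j₀ := Nat.find hcon
    obtain ⟨hj₀Q, hj₀bad⟩ := Nat.find_spec hcon
    have hj₀min : ∀ j < Nat.find hcon, j + 1 ≤ Q → D.IsInnerFace (cFace (cornerOrbit β p₂ (j + 1))) := by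
      intro j hj hjQ
      by_contra hbad
      exact Nat.find_min hcon hj ⟨hjQ, hbad⟩
    -- the toggled orbit exits at time `i₁ + 1 + j₀`
    set M := i₁ + 1 + Nat.find hcon with hM
    have hout : ¬ D.IsInnerFace (cFace (orb' M)) := by rw [hM, hloop _ hj₀Q]; exact hj₀bad
    have hinM : D.IsInnerFace (cFace (orb' (M - 1))) := by
      rcases Nat.eq_zero_or_pos (Nat.find hcon) with h0 | hpos
      · rw [show M - 1 = i₁ by omega, hpre i₁ le_rfl, hi₁]; exact hx _
      · rw [show M - 1 = i₁ + 1 + (Nat.find hcon - 1) by omega, hloop _ (by omega)]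
        exact hj₀min _ (by omega) (by omega)
    have hexit' : D.IsExitCorner (orb' (M - 1)) :=
      isExitCorner_cornerOrbit hD hc₀ hinM (by rwa [show M - 1 + 1 = M by omega])
    obtain ⟨N₁, rfl⟩ : ∃ N₁, N = N₁ + 1 := ⟨N - 1, by omega⟩
    have hexit : D.IsExitCorner (orb N₁) := isExitCorner_cornerOrbit hD hc₀ (hlt N₁ (Nat.lt_succ_self _)) hN
    have heq := hexit'.eq hD hexit
    rcases Nat.eq_zero_or_pos (Nat.find hcon) with h0 | hpos
    · -- then `p` itself would be the exit corner, but its vertex is interior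
      rw [show M - 1 = i₁ by omega, hpre i₁ le_rfl, hi₁] at heq
      exact (heq ▸ hexit).not_forall_isInnerFace hx
    · rw [show M - 1 = i₁ + 1 + (Nat.find hcon - 1) by omega, hloop _ (by omega),
        show Nat.find hcon - 1 + 1 = Nat.find hcon by omega] at heq
      exact hdisj _ _ heq
  refine ⟨hpre, hloop, htail, fun k hk => ?_, ?_⟩
  · -- Step E: all faces before `N + Q` are inner
    by_cases hk1 : k ≤ i₁
    · rw [hpre k hk1]; exact hlt k (by omega)
    · by_cases hk2 : k ≤ i₁ + Q
      · rw [show k = i₁ + 1 + (k - i₁ - 1) by omega, hloop _ (by omega)]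
        exact hloopin _ (by omega)
      · rw [show k = i₁ + Q + 1 + (k - i₁ - Q - 1) by omega, htail _ (by omega)]
        exact hlt _ (by omega)
  · have := htail (N - i₁ - 1) (by omega)
    rw [show i₁ + Q + 1 + (N - i₁ - 1) = N + Q by omega, show i₁ + 1 + (N - i₁ - 1) = N by omega] at this
    rwa [this]

end Cases

end Literature.Probability.LatticeModels
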